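import Summits.PneNP.PneNP.Theses.SymmetryBudget
import Literature.Computability.Complexity.SymmetricCircuit
import Literature.Computability.Complexity.CircuitProofs

/-!
# The non-uniform form of `HamCompiles` collapses `WindowHam` onto the plain circuit lower bound

Negative lemmas for crux `stmt-PneNP-10637` (`HamCompiles`, route `PneNP/SymmetryBudget`;
cdisprove seat `refuter-cdisprove-stmt-PneNP-10637-0`).

The crux is `NP ⊆ P → Concl` with `Concl := ∃ p ∀ m, HasSymCircuit tcBasis (Bud m ⌊log₂ m⌋) (p m) HAM_m`.
Every intended proof (NP ⊆ P ⇒ HAMCIRCUIT ∈ P ⇒ poly-size circuits for the slices of HAM ⇒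
equivariant re-compilation) in fact proves the NON-UNIFORM strengthening
`NU := HamPolySize → Concl`, where `HamPolySize := ∃ p ∀ m ∃ C over tcBasis, |C| ≤ p m ∧ C computes HAM_m`
(poly-size GENERAL threshold circuits; all auxiliary circuits a compilation could want are also
available from `HamPolySize`, since HAM ∈ P/poly gives PH ⊆ P/poly). The lemmas:

* `hamHardIO_of_nonuniform_of_windowHam`: `NU → WindowHam → HamHardIO`, where
  `HamHardIO := ∀ p, ∃ᶠ m, ¬∃ C over tcBasis, |C| ≤ p m ∧ C computes HAM_m` is the plain
  (non-symmetric, non-uniform) circuit lower bound for Hamiltonicity — `HAMCIRCUIT ∉ P/poly` in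
  the route's matrix-input convention. With the trivial converse (`HamHardIO → WindowHam`,
  symmetric circuits being circuits; a positive statement of a route item, kept in the crux
  workfile `Cruxes/HamCompiles/Disproof.lean`, not landed) this says: UNDER ANY CIRCUIT-BASED
  COMPILATION, CRUX #2 `WindowHam` IS EQUIVALENT TO A GENERAL CIRCUIT LOWER BOUND FOR HAM — the
  symmetry restriction of the window then buys no logical room, and the route's deciding theorem
  `WindowHam → HamCompiles → PneNP` is "HAM ∉ SIZE(poly) → P ≠ NP" re-phrased. Logical room
  survives only for a compilation that uses UNIFORMITY of the P-machine essentially.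
* `not_hamPolySize_iff_hamHardIO`: the `∃ m` and `∃ᶠ m` forms of the general lower bound agree
  (padding by a constant; per-`m` existence of general circuits is the proved tree fact
  `exists_computes_deMorgan_holds`, plus a constant circuit at `m = 0`).
-/

-- `Summit.PneNP.PneNP.…` duplicates `PneNP` BY DESIGN (single-problem summit, D-0017); the Summits
-- library sets this option globally (lakefile), repeated here so a standalone `lean check` is warning-free.
set_option linter.dupNamespace false

namespace Summit.PneNP.PneNP.Theorems.HamCompiles.Negative

open Literature.Computability.Complexity
open Summit.PneNP.PneNP.Theses.SymmetryBudget (HamCompiles WindowHam)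
open scoped Classical

/-- Padding a polynomial by a constant covering finitely many exceptional arguments. -/
theorem exists_poly_cover (p : Polynomial ℕ) (M : ℕ) (s : ℕ → ℕ) :
    ∃ p' : Polynomial ℕ, (∀ m, p.eval m ≤ p'.eval m) ∧ ∀ m < M, s m ≤ p'.eval m := by
  refine ⟨p + Polynomial.C (∑ i ∈ Finset.range M, s i), fun m => ?_, fun m hm => ?_⟩
  · simp
  · simp only [Polynomial.eval_add, Polynomial.eval_C]
    exact le_add_left (Finset.single_le_sum (f := s) (fun _ _ => Nat.zero_le _)
      (Finset.mem_range.2 hm))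

/-- `{∧₂, ∨₂, ¬} ⊆ tcBasis`. -/
theorem deMorganBasis_subset_tcBasis : deMorganBasis ⊆ tcBasis := by
  intro f hf
  simp only [deMorganBasis, Set.mem_insert_iff, Set.mem_singleton_iff] at hf
  refine acBasis_subset_tcBasis ?_
  rcases hf with rfl | rfl | rfl
  · exact Or.inr (Set.mem_iUnion.2 ⟨2, Or.inl rfl⟩)
  · exact Or.inr (Set.mem_iUnion.2 ⟨2, Or.inr rfl⟩)
  · exact Or.inl rfl

/-- The arity-0 disjunction is the constant-`false` gate. -/
theorem gateFn_const_false_eq : (⟨0, fun _ => false⟩ : GateFn) = GateFn.or 0 := by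
  simp only [GateFn.or]
  exact Sigma.ext rfl (heq_of_eq (funext fun v => by simp))

/-- On the empty matrix (`m = 0`) Hamiltonicity is the constant `false` (`card (Fin 0) ≠ 1`, no
vertex), computed by the one-gate circuit `∨₀`. -/
theorem exists_circuit_ham_zero : ∃ C : Circuit (Fin 0 × Fin 0),
    C.IsOver tcBasis ∧ C.size ≤ 1 ∧ C.Computes (fun x : Fin 0 × Fin 0 → Bool =>
      decide (SimpleGraph.fromRel fun u v => x (u, v) = true : SimpleGraph (Fin 0)).IsHamiltonian) := by
  refine ⟨Circuit.const (Fin 0 × Fin 0) false, ?_, le_rfl, fun x => ?_⟩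
  · intro g hg
    simp only [Circuit.const, List.mem_singleton] at hg
    subst hg
    show (⟨0, fun _ => false⟩ : GateFn) ∈ tcBasis
    rw [gateFn_const_false_eq]
    exact acBasis_subset_tcBasis (Or.inr (Set.mem_iUnion.2 ⟨0, Or.inr rfl⟩))
  · rw [Circuit.eval_const]
    symm
    rw [decide_eq_false_iff_not, SimpleGraph.IsHamiltonian]
    intro h
    obtain ⟨a, -⟩ := h (by simp)
    exact a.elim0

/-- Per-`m` existence of SOME general threshold circuit for `HAM_m`. -/
theorem exists_circuit_ham (m : ℕ) : ∃ s : ℕ, ∃ C : Circuit (Fin m × Fin m),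
    C.IsOver tcBasis ∧ C.size ≤ s ∧ C.Computes (fun x : Fin m × Fin m → Bool =>
      decide (SimpleGraph.fromRel fun u v => x (u, v) = true : SimpleGraph (Fin m)).IsHamiltonian) := by
  rcases Nat.eq_zero_or_pos m with rfl | hm
  · exact ⟨1, exists_circuit_ham_zero⟩
  · haveI : Nonempty (Fin m × Fin m) := ⟨(⟨0, hm⟩, ⟨0, hm⟩)⟩
    obtain ⟨C, hB, hf⟩ := exists_computes_deMorgan_holds (fun x : Fin m × Fin m → Bool =>
      decide (SimpleGraph.fromRel fun u v => x (u, v) = true : SimpleGraph (Fin m)).IsHamiltonian)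
    exact ⟨C.size, C, hB.mono deMorganBasis_subset_tcBasis, le_rfl, hf⟩

/-- The `∃ m` form and the `∃ᶠ m` form of "HAM has no polynomial-size threshold circuits" agree
(unconditionally, by padding). -/
theorem not_hamPolySize_iff_hamHardIO :
    (¬ ∃ p : Polynomial ℕ, ∀ m : ℕ, ∃ C : Circuit (Fin m × Fin m),
        C.IsOver tcBasis ∧ C.size ≤ p.eval m ∧ C.Computes (fun x : Fin m × Fin m → Bool =>
          decide (SimpleGraph.fromRel fun u v => x (u, v) = true :
            SimpleGraph (Fin m)).IsHamiltonian)) ↔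
    ∀ p : Polynomial ℕ, ∃ᶠ m in Filter.atTop, ¬ ∃ C : Circuit (Fin m × Fin m),
        C.IsOver tcBasis ∧ C.size ≤ p.eval m ∧ C.Computes (fun x : Fin m × Fin m → Bool =>
          decide (SimpleGraph.fromRel fun u v => x (u, v) = true :
            SimpleGraph (Fin m)).IsHamiltonian) := by
  constructor
  · intro h p
    rw [Filter.frequently_atTop]
    intro M
    choose s hs using exists_circuit_ham
    obtain ⟨p', hpp', hsp'⟩ := exists_poly_cover p M s
    have hex : ∃ m, ¬ ∃ C : Circuit (Fin m × Fin m),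
        C.IsOver tcBasis ∧ C.size ≤ p'.eval m ∧ C.Computes (fun x : Fin m × Fin m → Bool =>
          decide (SimpleGraph.fromRel fun u v => x (u, v) = true :
            SimpleGraph (Fin m)).IsHamiltonian) := by
      by_contra hall
      push Not at hall
      exact h ⟨p', hall⟩
    obtain ⟨m, hm⟩ := hex
    refine ⟨m, ?_, ?_⟩
    · by_contra hlt
      obtain ⟨C, hB, hsC, hf⟩ := hs m
      exact hm ⟨C, hB, hsC.trans (hsp' m (Nat.lt_of_not_le hlt)), hf⟩
    · rintro ⟨C, hB, hsC, hf⟩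
      exact hm ⟨C, hB, hsC.trans (hpp' m), hf⟩
  · rintro h ⟨p, hp⟩
    obtain ⟨m, hm⟩ := (h p).exists
    exact hm (hp m)

/-- **Collapse.** Under the non-uniform compilation (first hypothesis: poly-size general threshold
circuits for HAM at every `m` compile into poly-size Bud(m,⌊log₂ m⌋)-symmetric ones — what every
circuit-based proof of `HamCompiles` establishes), crux #2 `WindowHam` already yields the plain
circuit lower bound for Hamiltonicity: for every polynomial `p`, infinitely often no `tcBasis`
circuit of size `≤ p m` computes `HAM_m`. -/
theorem hamHardIO_of_nonuniform_of_windowHam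
    (hNU : (∃ p : Polynomial ℕ, ∀ m : ℕ, ∃ C : Circuit (Fin m × Fin m),
        C.IsOver tcBasis ∧ C.size ≤ p.eval m ∧ C.Computes (fun x : Fin m × Fin m → Bool =>
          decide (SimpleGraph.fromRel fun u v => x (u, v) = true :
            SimpleGraph (Fin m)).IsHamiltonian)) →
      ∃ p : Polynomial ℕ, ∀ m : ℕ,
        HasSymCircuit tcBasis (pointStabiliserBudget m (Nat.log 2 m)) (p.eval m)
          (fun x : Fin m × Fin m → Bool =>
            decide (SimpleGraph.fromRel fun u v => x (u, v) = true :
              SimpleGraph (Fin m)).IsHamiltonian))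
    (hW : WindowHam) :
    ∀ p : Polynomial ℕ, ∃ᶠ m in Filter.atTop, ¬ ∃ C : Circuit (Fin m × Fin m),
        C.IsOver tcBasis ∧ C.size ≤ p.eval m ∧ C.Computes (fun x : Fin m × Fin m → Bool =>
          decide (SimpleGraph.fromRel fun u v => x (u, v) = true :
            SimpleGraph (Fin m)).IsHamiltonian) := by
  refine not_hamPolySize_iff_hamHardIO.1 fun hP => ?_
  obtain ⟨p, hp⟩ := hNU hP
  obtain ⟨m, hm⟩ := ((show ∀ p : Polynomial ℕ, ∃ᶠ m in Filter.atTop,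
      ¬ HasSymCircuit tcBasis (pointStabiliserBudget m (Nat.log 2 m)) (p.eval m)
          (fun x : Fin m × Fin m → Bool =>
            decide (SimpleGraph.fromRel fun u v => x (u, v) = true :
              SimpleGraph (Fin m)).IsHamiltonian) from hW) p).exists
  exact hm (hp m)

/-- The non-uniform compilation hypothesis is equivalent to: for HAM, "poly-size
Bud(m,⌊log₂ m⌋)-symmetric" and "poly-size general" threshold circuits are the SAME condition
(symmetric circuits are circuits). -/
theorem nonuniform_iff_sym_iff_general :
    ((∃ p : Polynomial ℕ, ∀ m : ℕ, ∃ C : Circuit (Fin m × Fin m),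
        C.IsOver tcBasis ∧ C.size ≤ p.eval m ∧ C.Computes (fun x : Fin m × Fin m → Bool =>
          decide (SimpleGraph.fromRel fun u v => x (u, v) = true :
            SimpleGraph (Fin m)).IsHamiltonian)) →
      ∃ p : Polynomial ℕ, ∀ m : ℕ,
        HasSymCircuit tcBasis (pointStabiliserBudget m (Nat.log 2 m)) (p.eval m)
          (fun x : Fin m × Fin m → Bool =>
            decide (SimpleGraph.fromRel fun u v => x (u, v) = true :
              SimpleGraph (Fin m)).IsHamiltonian)) ↔
    ((∃ p : Polynomial ℕ, ∀ m : ℕ, ∃ C : Circuit (Fin m × Fin m),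
        C.IsOver tcBasis ∧ C.size ≤ p.eval m ∧ C.Computes (fun x : Fin m × Fin m → Bool =>
          decide (SimpleGraph.fromRel fun u v => x (u, v) = true :
            SimpleGraph (Fin m)).IsHamiltonian)) ↔
      ∃ p : Polynomial ℕ, ∀ m : ℕ,
        HasSymCircuit tcBasis (pointStabiliserBudget m (Nat.log 2 m)) (p.eval m)
          (fun x : Fin m × Fin m → Bool =>
            decide (SimpleGraph.fromRel fun u v => x (u, v) = true :
              SimpleGraph (Fin m)).IsHamiltonian)) := by
  refine ⟨fun h => ⟨h, ?_⟩, fun h => h.1⟩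
  rintro ⟨p, hp⟩
  refine ⟨p, fun m => ?_⟩
  obtain ⟨C, hB, hs, -, hf⟩ := hp m
  exact ⟨C, hB, hs, hf⟩

end Summit.PneNP.PneNP.Theorems.HamCompiles.Negative
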